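import Mathlib
import Summits.ValiantsHypothesis.ValiantsHypothesis.Theorems.BarrierLeverPartitionMinorsHitByVPHiddenStatesCoStarAffine

/-!
# Route BarrierLever — item `PartitionMinorsHitByVP` (stmt-ValiantsHypothesis-19717), line `hidden-states`:
# THE CO-STAR CONJECTURE (typed) and its transfer to the conjecture node at the top `h + 1` sizes

Helper file (`--supports stmt-ValiantsHypothesis-19717`; cell valiant-natproofs, rung V4, 𝒟-side door (c); prover seat val-np-p6 gen 10).
Definition-free (the conjecture appears as the HYPOTHESIS of the transfer theorem); closes NO item.

THE CO-STAR DESIGN `T_{h,c}`: ONE piece with `K = h` states whose members are all state sets except the top `univ` and the `c` co-singletons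
`univ ∖ {qs j}` (`qs` injective, so `c ≤ h`); size `2^h − (c+1)`. It is a legal STRICT THRESHOLD family for the weights «1 on the special
states `qs j`, 2 elsewhere»: every member weighs `≤ 2h − 2 − c`, the missing co-singletons weigh `2h − 1 − c`, the top `2h − c`
(`coStar_weight_le`, `coStar_design`).

THE CO-STAR CONJECTURE (the hypothesis `hC` of `universalJoinWide_of_coStarAll`, verbatim): for all `h, c` and every injective enumeration `cols` of the members of `T_{h,c}`, EVERY injective row
family `u` of size `2^h − (c+1)` admits a table with nonsingular design matrix. EVIDENCE (this seat, memo HOME/val-np-p6/g10 §9–9′, kit j302814/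
j302815/j302816/j302966): exhaustive over all injective families for h ≤ 5 (906 192 families at (h,c+1) = (5,6)), over all down-sets for h ≤ 7,
0 failures; every other threshold co-shape fails. PROVED CASES: `c = 0` (`CoStar.coStarTop_exists_table`, p614189), `c = 1`
(`coStar_exists_table_pair`, p615482), `c = 2` (`coStar_exists_table_triple`, `…CoStarTriple`), and every `(u, c)` whose missing rows are affinely
independent (`coStar_exists_table_of_indep`).

TRANSFER `universalJoinWide_of_coStarAll`: the conjecture gives the body of `Stmt.stub_universalJoinWide` at EVERY `(h, 2^h − (c+1))` with
`c ≤ h`, `1 ≤ h`, with `m = 1` piece — the top bookend dual to the star range `r ≤ 2h(h³+1)` (`StarJoin.universalJoinWide_of_le`).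

WHAT THIS IS NOT: the conjecture is OPEN for `c ≥ 3`; it covers only the top `h+1` sizes of each `h` (thin: pieces cannot exceed `2^h` members);
for the crux these co-sizes are unconditional anyway (`…Cosmall`); nothing on crux 14610 or VP ≠ VNP.
-/

set_option linter.dupNamespace false

namespace Summit.ValiantsHypothesis.ValiantsHypothesis.Theorems.BarrierLever.HiddenStates

open Finset Matrix

noncomputable section

namespace CoStar

/-! ## The co-star design is a legal strict threshold family -/

/-- Weight bound: with weight 1 on the special states and 2 elsewhere, every `J ⊆ Fin h` weighs at most `|J| + (h − c)`, i.e.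
`Σ_{q∈J} w q + c ≤ |J| + h` (the `c` special states are injectively indexed). -/
theorem coStar_weight_le {h c : ℕ} (qs : Fin c → Fin h) (hqs : Function.Injective qs) (J : Finset (Fin h)) :
    ∑ q ∈ J, (if q ∈ Finset.univ.image qs then 1 else 2) + c ≤ J.card + h := by
  classical
  set Q : Finset (Fin h) := Finset.univ.image qs with hQ
  have hQc : Q.card = c := by
    rw [hQ, Finset.card_image_of_injective _ hqs, Finset.card_univ, Fintype.card_fin]
  -- Σ_{q∈J} w q = 2|J| − |J ∩ Q|
  have hsum : ∑ q ∈ J, (if q ∈ Q then 1 else 2) + (J ∩ Q).card = 2 * J.card := by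
    rw [← Finset.sum_filter_add_sum_filter_not J (fun q => q ∈ Q)]
    rw [Finset.sum_congr rfl fun q hq => if_pos (Finset.mem_filter.mp hq).2,
      Finset.sum_congr rfl fun q hq => if_neg (Finset.mem_filter.mp hq).2, Finset.sum_const, Finset.sum_const,
      smul_eq_mul, smul_eq_mul, Finset.filter_mem_eq_inter]
    have := Finset.card_filter_add_card_filter_not (s := J) (fun q => q ∈ Q)
    rw [Finset.filter_mem_eq_inter] at this
    omega
  -- |J ∩ Q| ≥ |J| + c − h
  have hinter : J.card + c ≤ (J ∩ Q).card + h := by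
    have h1 := Finset.card_union_add_card_inter J Q
    have h2 : (J ∪ Q).card ≤ h := by
      have := Finset.card_le_univ (J ∪ Q); rwa [Fintype.card_fin] at this
    omega
  omega

/-- **The co-star design exists and is legal.** For `1 ≤ h` and `qs : Fin c → Fin h` injective there is an injective enumeration `cols` of all state
sets other than `univ`, `univ ∖ {qs j}` by `Fin r`, `r + (c+1) = 2^h`, and the one-piece design `k ↦ (0, cols k)` is a legal strict threshold
family (weights 1/2), within the wide budget (`m = 1 ≤ 2h`, `K = h ≤ h³`). -/
theorem coStar_design (h c r : ℕ) (h1 : 1 ≤ h) (qs : Fin c → Fin h) (hqs : Function.Injective qs) (hr : r + (c + 1) = 2 ^ h) :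
    ∃ cols : Fin r → Finset (Fin h), Function.Injective cols ∧ (∀ k, cols k ≠ Finset.univ) ∧
      (∀ k j, cols k ≠ Finset.univ.erase (qs j)) ∧
      (∀ x : Fin 1 × Finset (Fin h), x ∉ Set.range (fun k => ((0 : Fin 1), cols k)) →
        ∀ i, (fun _ : Fin 1 => 0) ((0 : Fin 1)) + ∑ q ∈ cols i, (fun (_ : Fin 1) (q : Fin h) => if q ∈ Finset.univ.image qs then 1 else 2) 0 q
          < (fun _ : Fin 1 => 0) x.1 + ∑ q ∈ x.2, (fun (_ : Fin 1) (q : Fin h) => if q ∈ Finset.univ.image qs then 1 else 2) x.1 q) := by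
  classical
  set Q : Finset (Fin h) := Finset.univ.image qs with hQ
  have hQc : Q.card = c := by
    rw [hQ, Finset.card_image_of_injective _ hqs, Finset.card_univ, Fintype.card_fin]
  have hch : c ≤ h := by
    have := Finset.card_le_univ Q; rw [Fintype.card_fin] at this; omega
  -- the excluded sets
  set N : Finset (Finset (Fin h)) := insert Finset.univ (Q.image fun q => Finset.univ.erase q) with hN
  have herase_inj : Set.InjOn (fun q : Fin h => (Finset.univ : Finset (Fin h)).erase q) ↑Q := by
    intro q _ q' _ hqq
    by_contra hne
    have : q' ∈ (Finset.univ : Finset (Fin h)).erase q := Finset.mem_erase.mpr ⟨fun hh => hne hh.symm, Finset.mem_univ _⟩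
    simp only at hqq
    rw [hqq] at this
    exact Finset.notMem_erase q' _ this
  have hNcard : N.card = c + 1 := by
    rw [hN, Finset.card_insert_of_notMem, Finset.card_image_of_injOn herase_inj, hQc]
    intro hmem
    obtain ⟨q, -, hq⟩ := Finset.mem_image.mp hmem
    have : q ∈ (Finset.univ : Finset (Fin h)).erase q := by rw [hq]; exact Finset.mem_univ q
    exact Finset.notMem_erase q _ this
  set D : Finset (Finset (Fin h)) := Finset.univ \ N with hD
  have hDcard : D.card = r := by
    rw [hD, Finset.card_sdiff_of_subset (Finset.subset_univ _), Finset.card_univ, Fintype.card_finset, Fintype.card_fin, hNcard]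
    omega
  let ε : {x // x ∈ D} ≃ Fin r := (Finset.equivFin D).trans (finCongr hDcard)
  let cols : Fin r → Finset (Fin h) := fun k => (ε.symm k).1
  have hcols : Function.Injective cols := fun k k' hkk => ε.symm.injective (Subtype.ext hkk)
  have hmemD : ∀ k, cols k ∈ D := fun k => (ε.symm k).2
  have hnotN : ∀ k, cols k ∉ N := by
    intro k; have := hmemD k; rw [hD, Finset.mem_sdiff] at this; exact this.2
  have hcu : ∀ k, cols k ≠ Finset.univ := by
    intro k hk; apply hnotN k; rw [hN, hk]; exact Finset.mem_insert_self _ _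
  have hcq : ∀ k j, cols k ≠ Finset.univ.erase (qs j) := by
    intro k j hk; apply hnotN k; rw [hN, Finset.mem_insert]; right
    exact Finset.mem_image.mpr ⟨qs j, Finset.mem_image.mpr ⟨j, Finset.mem_univ _, rfl⟩, hk.symm⟩
  have hsurj : ∀ J, J ∉ N → ∃ k, cols k = J := by
    intro J hJ
    have hJD : J ∈ D := by rw [hD, Finset.mem_sdiff]; exact ⟨Finset.mem_univ _, hJ⟩
    exact ⟨ε ⟨J, hJD⟩, by simp [cols]⟩
  refine ⟨cols, hcols, hcu, hcq, ?_⟩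
  -- legality
  intro x hx i
  have hxN : x.2 ∈ N := by
    by_contra hno
    obtain ⟨k, hk⟩ := hsurj x.2 hno
    apply hx
    refine ⟨k, ?_⟩
    ext1
    · exact Subsingleton.elim _ _
    · exact hk
  show 0 + ∑ q ∈ cols i, (if q ∈ Finset.univ.image qs then 1 else 2) < 0 + ∑ q ∈ x.2, (if q ∈ Finset.univ.image qs then 1 else 2)
  rw [zero_add, zero_add, ← hQ]
  -- member weight ≤ 2h − 2 − c
  have hmem : ∑ q ∈ cols i, (if q ∈ Q then 1 else 2) + c + 2 ≤ 2 * h := by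
    have hw := coStar_weight_le qs hqs (cols i)
    rw [← hQ] at hw
    have hlt : cols i ⊂ Finset.univ := Finset.ssubset_univ_iff.mpr (hcu i)
    have hcard := Finset.card_lt_card hlt
    rw [Finset.card_univ, Fintype.card_fin] at hcard
    by_cases hsmall : (cols i).card + 2 ≤ h
    · omega
    · -- |cols i| = h − 1: cols i = univ.erase y with y ∉ Q, so every special state lies in cols i
      have hcard' : (cols i).card = h - 1 := by omega
      have hsub : Q ⊆ cols i := by
        intro q hq
        by_contra hqn
        obtain ⟨j, -, rfl⟩ := Finset.mem_image.mp hq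
        apply hcq i j
        apply Finset.eq_of_subset_of_card_le
        · intro y hy; rw [Finset.mem_erase]; exact ⟨fun hh => hqn (hh ▸ hy), Finset.mem_univ _⟩
        · rw [Finset.card_erase_of_mem (Finset.mem_univ _), Finset.card_univ, Fintype.card_fin, hcard']
      -- then the weight is 2(h−1) − c exactly
      have hsum : ∑ q ∈ cols i, (if q ∈ Q then 1 else 2) + (cols i ∩ Q).card = 2 * (cols i).card := by
        rw [← Finset.sum_filter_add_sum_filter_not (cols i) (fun q => q ∈ Q)]
        rw [Finset.sum_congr rfl fun q hq => if_pos (Finset.mem_filter.mp hq).2,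
          Finset.sum_congr rfl fun q hq => if_neg (Finset.mem_filter.mp hq).2, Finset.sum_const, Finset.sum_const,
          smul_eq_mul, smul_eq_mul, Finset.filter_mem_eq_inter]
        have := Finset.card_filter_add_card_filter_not (s := cols i) (fun q => q ∈ Q)
        rw [Finset.filter_mem_eq_inter] at this
        omega
      have hint : (cols i ∩ Q).card = c := by
        rw [Finset.inter_eq_right.mpr hsub, hQc]
      omega
  -- non-member weight ≥ 2h − 1 − c
  have hnon : 2 * h ≤ ∑ q ∈ x.2, (if q ∈ Q then 1 else 2) + c + 1 := by
    have hsum : ∀ J : Finset (Fin h), ∑ q ∈ J, (if q ∈ Q then 1 else 2) + (J ∩ Q).card = 2 * J.card := by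
      intro J
      rw [← Finset.sum_filter_add_sum_filter_not J (fun q => q ∈ Q)]
      rw [Finset.sum_congr rfl fun q hq => if_pos (Finset.mem_filter.mp hq).2,
        Finset.sum_congr rfl fun q hq => if_neg (Finset.mem_filter.mp hq).2, Finset.sum_const, Finset.sum_const,
        smul_eq_mul, smul_eq_mul, Finset.filter_mem_eq_inter]
      have := Finset.card_filter_add_card_filter_not (s := J) (fun q => q ∈ Q)
      rw [Finset.filter_mem_eq_inter] at this
      omega
    rw [hN, Finset.mem_insert] at hxN
    rcases hxN with hx2 | hx2
    · have := hsum x.2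
      rw [hx2] at this ⊢
      rw [Finset.univ_inter, hQc, Finset.card_univ, Fintype.card_fin] at this
      omega
    · obtain ⟨q, hq, hx2'⟩ := Finset.mem_image.mp hx2
      have := hsum x.2
      rw [← hx2'] at this ⊢
      have hint : ((Finset.univ : Finset (Fin h)).erase q ∩ Q).card + 1 = c := by
        have : (Finset.univ : Finset (Fin h)).erase q ∩ Q = Q.erase q := by
          ext y; simp only [Finset.mem_inter, Finset.mem_erase, Finset.mem_univ, and_true]
        rw [this, Finset.card_erase_of_mem hq, hQc]
        have : 1 ≤ Q.card := Finset.card_pos.mpr ⟨q, hq⟩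
        omega
      rw [Finset.card_erase_of_mem (Finset.mem_univ _), Finset.card_univ, Fintype.card_fin] at this
      omega
  omega

/-! ## The conjecture implies the node at the top `h + 1` sizes -/

/-- **CO-STAR ⇒ the conjecture node at `r = 2^h − (c+1)`** for every `h ≥ 1` and `c ≤ h`, with ONE piece and `K = h` states. -/
theorem universalJoinWide_of_coStarAll
    (hC : ∀ (h c r m : ℕ) (p₀ : Fin m) (qs : Fin c → Fin h), Function.Injective qs → r + (c + 1) = 2 ^ h →
      ∀ cols : Fin r → Finset (Fin h), Function.Injective cols → (∀ k, cols k ≠ Finset.univ) →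
        (∀ k j, cols k ≠ Finset.univ.erase (qs j)) →
        ∀ u : Fin r → Finset (Fin h), Function.Injective u →
          ∃ tx : Fin m → Option (Fin h) → Fin h → ℂ,
            (Matrix.of fun i k : Fin r =>
              ∏ x ∈ u i, (tx p₀ none x + ∑ q ∈ cols k, tx p₀ (some q) x)).det ≠ 0)
    (h c r : ℕ) (h1 : 1 ≤ h) (hc : c ≤ h) (hr : r + (c + 1) = 2 ^ h) :
    ∃ (m K : ℕ) (W : Fin m → ℕ) (wt : Fin m → Fin K → ℕ) (e : Fin r → Fin m × Finset (Fin K)),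
      m ≤ h + h ∧ K ≤ h * h * h ∧ Function.Injective e ∧
      (∀ x : Fin m × Finset (Fin K), x ∉ Set.range e →
        ∀ i, W (e i).1 + ∑ k ∈ (e i).2, wt (e i).1 k < W x.1 + ∑ k ∈ x.2, wt x.1 k) ∧
      ∀ u : Fin r → Finset (Fin h), Function.Injective u →
        ∃ tx : Fin m → Option (Fin K) → Fin h → ℂ,
          (Matrix.of fun i k : Fin r =>
            ∏ a ∈ u i, (tx (e k).1 none a + ∑ q ∈ (e k).2, tx (e k).1 (some q) a)).det ≠ 0 := by
  classical
  -- the special states: the first `c` states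
  let qs : Fin c → Fin h := fun j => Fin.castLE hc j
  have hqs : Function.Injective qs := fun j j' hjj => Fin.castLE_injective hc hjj
  obtain ⟨cols, hcols, hcu, hcq, hthr⟩ := coStar_design h c r h1 qs hqs hr
  refine ⟨1, h, fun _ => 0, fun _ q => if q ∈ Finset.univ.image qs then 1 else 2, fun k => ((0 : Fin 1), cols k), by omega,
    le_trans (Nat.le_mul_of_pos_right h h1) (Nat.le_mul_of_pos_right _ h1), ?_, hthr, ?_⟩
  · intro k k' hkk
    exact hcols (congrArg Prod.snd hkk)
  · intro u hu
    exact hC h c r 1 (0 : Fin 1) qs hqs hr cols hcols hcu hcq u hu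

/-- The conjecture restricted to `c = 0` holds (p614189). -/
theorem coStarAll_zero (h r m : ℕ) (p₀ : Fin m) (qs : Fin 0 → Fin h) (_hqs : Function.Injective qs) (hr : r + (0 + 1) = 2 ^ h)
    (cols : Fin r → Finset (Fin h)) (hcols : Function.Injective cols) (hcu : ∀ k, cols k ≠ Finset.univ)
    (_hcq : ∀ k j, cols k ≠ Finset.univ.erase (qs j)) (u : Fin r → Finset (Fin h)) (hu : Function.Injective u) :
    ∃ tx : Fin m → Option (Fin h) → Fin h → ℂ,
      (Matrix.of fun i k : Fin r =>
        ∏ x ∈ u i, (tx p₀ none x + ∑ q ∈ cols k, tx p₀ (some q) x)).det ≠ 0 :=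
  coStarTop_exists_table p₀ u hu cols hcols hcu hr

/-- The conjecture restricted to `c = 1` holds (p615482). -/
theorem coStarAll_one (h r m : ℕ) (p₀ : Fin m) (qs : Fin 1 → Fin h) (_hqs : Function.Injective qs) (hr : r + (1 + 1) = 2 ^ h)
    (cols : Fin r → Finset (Fin h)) (hcols : Function.Injective cols) (hcu : ∀ k, cols k ≠ Finset.univ)
    (hcq : ∀ k j, cols k ≠ Finset.univ.erase (qs j)) (u : Fin r → Finset (Fin h)) (hu : Function.Injective u) :
    ∃ tx : Fin m → Option (Fin h) → Fin h → ℂ,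
      (Matrix.of fun i k : Fin r =>
        ∏ x ∈ u i, (tx p₀ none x + ∑ q ∈ cols k, tx p₀ (some q) x)).det ≠ 0 :=
  coStar_exists_table_pair p₀ u hu hr cols hcols (qs 0) hcu (fun k => hcq k 0)

end CoStar

end

end Summit.ValiantsHypothesis.ValiantsHypothesis.Theorems.BarrierLever.HiddenStates
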